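import Summits.HodgeConjecture.HodgeConjecture.Theorems.H413FinCoeffNonvanishing
import Literature.NumberTheory.Li1992.RallisLocalFactorEulerProduct
import HarnessLib

/-!
# H413 ∕ S4′(ii) (FIN) — CAPSTONE: a factorizable `Φ_f` whose finite Fourier coefficient against `conj χ₁(det⁻¹ ·)` is NON-ZERO

Crux H413 (stmt-HodgeConjecture-24833), line `F0_P4AdmissibleOccursInH1`, stub S4b (`θ_t ≠ 0`), row `hne` ∕ `hfin` of ★
`ThetaNonvanishing.dist_ne_zero_of_rallis_of_eigen_of_finCoeff` (`H413ThetaDistNonvanishingOfRallis`).  This file CLOSES the finite half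
«(F2) ∘ (F3) ∘ (F3′) ∘ (F4)» of [Li1992, Thm 2.1 (27)] in the tree's currency, with NO displayed row left:

  **`exists_finCoeff_ne_zero_of_localSplittings`** — for a restricted family `𝓢` of local splittings of `U(J_V ⊗ J₁)(F_v)` (`J₁` a hermitian
  LINE, big rank `n ≥ 3`) with `L²(μ'_vⁿ)`-isometric local Weil representations, a continuous unitary character `χ₁` of `E¹(𝔸_{F,f})`, any
  additive Haar measure `μ` on `𝔸_{F,f}ⁿ`, any Haar measure `μ_f` on `U(J₁)(𝔸_{F,f})` and local Haar measures `ν^W_v` normalised off `S₀ ∋ i₀`: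
  THERE IS a pure tensor `Φ_f = ⊗_v Φ_v` (`Φ_v = 1_{𝒪_vⁿ}` off a finite set) with
  `∫_{U(J₁)(𝔸_f)} ⟨Ω(1 ⊗ b) Φ_f, Φ_f⟩_μ · \overline{χ₁(det⁻¹ b)} dμ_f(b) ≠ 0`  (`Ω = ⊗'_v ω_v` the place-assembled Weil representation of `𝓢`,
  `det⁻¹ = finAdelicCenterInv`: `U(J₁)(𝔸_f) ≅ E¹(𝔸_f)`).

Assembly: ★ `integral_finCoeff_ne_zero_of_localFactors` (F0P4-p07, the Euler exchange ★ `exists_integral_finAdelic_eq_tprod` + (F2) ★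
`finCoeff_isPureTensor_of_Omega_line`) fed with the FOUR ROWS of ★ `Li1992/RallisLocalFactorEulerProduct.exists_family_localFactor_rows`
(F0P4-p02: (F3′) eventual bounds + (F4) test vectors of F0P4-p08), the weight `w = conj ∘ χ₁ ∘ det⁻¹` (continuous unitary ⇒ box-trivial at some
level, ★ `exists_forall_boxSubgroup_eq_one`; its local components are `conj χ_{1,v}` BY `rfl`), and the unramified clause of `𝓢` (`1_{𝒪ⁿ}` fixed
off a finite set).  The pin's consumer rewrites `R_{e₁} ∘ ω_f^{s_χ}(1,b) ∘ R_{e₁}⁻¹ = Ω_χ(1 ⊗ b)` (★ `WeilCoinv.finPairRep_chiSplittingLine_apply`)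
and `wfin = conj ∘ χ₁ ∘ det⁻¹` (N3) to obtain the `hfin` binder verbatim.  KERNEL: one theorem, DEF-FREE, no `sorry`.
HC_CM is proved only modulo the printed citations until rung 0 closes.

[cite: Li1992, Thm 2.1 (27) p. 184; §5 p. 206] [cite: TateThesis1967, Thm 3.3.1]
-/

set_option autoImplicit false
set_option linter.dupNamespace false

noncomputable section

open scoped RestrictedProduct ENNReal NNReal ComplexConjugate Matrix Kronecker
open MeasureTheory NumberField IsDedekindDomain Filter Function Set Topology
open Literature.NumberTheory.Automorphic Literature.NumberTheory.Automorphic.UnitaryGroup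
open Literature.NumberTheory.GelbartRogawski1991.UnitaryDualPair.LocalSplitting
open HodgeCM.PerL34 HodgeCM.PerL34.RestrictedMeasure HodgeCM.PerL34.PureTensor HodgeCM.PerL34.NoSmallSubgroups

namespace Summit.HodgeConjecture.HodgeConjecture.Cruxes.H413.ThetaNonvanishing

section Family

variable (F E : Type) [Field F] [NumberField F] [Field E] [NumberField E] [Algebra F E]
  [Algebra.IsQuadraticExtension F E] (c : E ≃ₐ[F] E) (N : ℕ) {n : ℕ} (e : Fin N × Fin 1 ≃ Fin n)
  (JV : Matrix (Fin N) (Fin N) E) (J₁ : Matrix (Fin 1) (Fin 1) E) (hJ₁ : J₁ 0 0 ≠ 0)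
  {δ : E} (hcδ : c δ = -δ) (hδ : δ ≠ 0) {d : F} (hd : δ * δ = algebraMap F E d)
  (Tb : Matrix (Fin n) (Fin n) F) (hTb : Tb.IsSymm) (hJb : Matrix.reindex e e (JV ⊗ₖ J₁) = Tb.map (algebraMap F E))
  (𝓢 : FinLocalSplittings F E c n hcδ hδ hd Tb hTb hJb) (hTd : IsUnit Tb.det) (h3 : 3 ≤ n) (hJ₁c : (J₁.map c)ᵀ = J₁)
  {χ₁ : finAdelicOne F E c →* ℂˣ} (hχ₁ : Continuous χ₁) (hχ₁u : ∀ x, ‖((χ₁ x : ℂˣ) : ℂ)‖ = 1)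
  [MeasurableSpace (FiniteAdeleRing (𝓞 F) F)] [BorelSpace (FiniteAdeleRing (𝓞 F) F)]
  [∀ v : HeightOneSpectrum (𝓞 F), MeasurableSpace (v.adicCompletion F)]
  [∀ v : HeightOneSpectrum (𝓞 F), BorelSpace (v.adicCompletion F)]
  (μ' : ∀ v : HeightOneSpectrum (𝓞 F), Measure (v.adicCompletion F)) [∀ v, (μ' v).IsAddHaarMeasure]
  (hL2 : ∀ v : HeightOneSpectrum (𝓞 F), (𝓢.omegaLoc v).IsL2Isometric (Measure.pi fun _ : Fin n => μ' v))
  (μ : Measure (Fin n → FiniteAdeleRing (𝓞 F) F)) [μ.IsAddHaarMeasure]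
  [∀ v : HeightOneSpectrum (𝓞 F), MeasurableSpace (localPi E c 1 J₁ v)]
  [∀ v : HeightOneSpectrum (𝓞 F), BorelSpace (localPi E c 1 J₁ v)]
  [MeasurableSpace (finAdelic F E c 1 J₁)] [BorelSpace (finAdelic F E c 1 J₁)]
  (μf : Measure (finAdelic F E c 1 J₁)) [μf.IsHaarMeasure]
  (νW : ∀ v : HeightOneSpectrum (𝓞 F), Measure (localPi E c 1 J₁ v)) [∀ v, (νW v).IsHaarMeasure] [∀ v, SigmaFinite (νW v)]
  (S₀ : Finset (HeightOneSpectrum (𝓞 F))) {i₀ : HeightOneSpectrum (𝓞 F)} (hi₀ : i₀ ∈ S₀)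
  (hB1 : ∀ v, v ∉ S₀ → νW v (localInt E c 1 J₁ v : Set (localPi E c 1 J₁ v)) = 1)

include hTd h3 hJ₁c hχ₁ hχ₁u hL2 hi₀ hB1 in
/-- **(FIN) CAPSTONE — a factorizable test vector with non-zero finite Fourier coefficient.**  With `𝓢`, `χ₁`, `μ`, `μ_f`, `ν^W` as in the
section header (`n ≥ 3`): there is a restricted family `Φ = (Φ_v)_v` of local Schwartz–Bruhat functions such that
`∫_{U(J₁)(𝔸_{F,f})} (∫ (Ω(1 ⊗ b)(⊗Φ_v))(y) \overline{(⊗Φ_v)(y)} dμ(y)) · \overline{χ₁(det⁻¹ b)} dμ_f(b) ≠ 0` — the Euler product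
`∏'_v I_v(Φ_v)` of [Li1992, (27)] converges and no factor vanishes (spherical factors `1 + O(N(v)^{-n/2})` off a finite set, test vectors on it).
[cite: Li1992, Thm 2.1 (27) p. 184; §5 p. 206] [cite: TateThesis1967, Thm 3.3.1] -/
theorem exists_finCoeff_ne_zero_of_localSplittings :
    ∃ Φ : LocalSBFamily F (Fin n),
      ∫ b, (∫ y, ((𝓢.Omega (finPairEmb F E c N 1 e JV J₁ (1, b)) (piProdSB F (Fin n) Φ) :
            ↥(SchwartzBruhat (Fin n → FiniteAdeleRing (𝓞 F) F))) : (Fin n → FiniteAdeleRing (𝓞 F) F) → ℂ) y *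
          conj (((piProdSB F (Fin n) Φ : ↥(SchwartzBruhat (Fin n → FiniteAdeleRing (𝓞 F) F))) :
            (Fin n → FiniteAdeleRing (𝓞 F) F) → ℂ) y) ∂μ) *
        conj (((χ₁ (finAdelicCenterInv F E c J₁ hJ₁ b) : ℂˣ) : ℂ)) ∂μf ≠ 0 := by
  classical
  -- the weight `w = conj ∘ χ₁ ∘ det⁻¹` as a multiplicative map, continuous and unitary
  let ψ : finAdelic F E c 1 J₁ →* ℂˣ := χ₁.comp (finAdelicCenterInv F E c J₁ hJ₁)
  let w : finAdelic F E c 1 J₁ →* ℂ := ((starRingEnd ℂ).toMonoidHom.comp (Units.coeHom ℂ)).comp ψ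
  have hw_apply : ∀ b, w b = conj (((χ₁ (finAdelicCenterInv F E c J₁ hJ₁ b) : ℂˣ) : ℂ)) := fun _ => rfl
  have hψc : Continuous fun b => ((ψ b : ℂˣ) : ℂ) :=
    Units.continuous_val.comp (hχ₁.comp (continuous_finAdelicCenterInv F E c J₁ hJ₁))
  have hψu : ∀ b, ‖((ψ b : ℂˣ) : ℂ)‖ = 1 := fun b => hχ₁u _
  have hwc : Continuous w := Complex.continuous_conj.comp hψc
  obtain ⟨Tw, hTw⟩ := exists_forall_boxSubgroup_eq_one F E c 1 J₁ ψ hψc hψu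
  -- the unramified clause of `𝓢`: `1_{𝒪_vⁿ}` is fixed by `U(J)(𝒪_v)` off a finite set
  obtain ⟨Tρ, hTρ⟩ : ∃ Tρ : Finset (HeightOneSpectrum (𝓞 F)), ∀ v, v ∉ Tρ →
      unitVec F (Fin n) v ∈ (𝓢.omegaLoc v).fixedPoints (localInt E c n (Matrix.reindex e e (JV ⊗ₖ J₁)) v) := by
    have hu := 𝓢.unramified
    rw [Filter.eventually_cofinite] at hu
    refine ⟨hu.toFinset, fun v hv => ?_⟩
    have hv' := not_not.1 fun h => hv (hu.mem_toFinset.2 h)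
    exact ((𝓢.omegaLoc v).mem_fixedPoints _ _).2 fun k hk => hv' k hk
  -- the four rows of the (F3′) file, at a level `Tf ⊇ Tw ∪ Tρ ∪ S₀`
  obtain ⟨Tf, Φ, hT₀, hS₀, hΦoff, hrows⟩ := 𝓢.exists_family_localFactor_rows J₁ hJ₁ hTd h3 hJ₁c hχ₁ hχ₁u μ' hL2 νW S₀ hB1 (Tw ∪ Tρ)
  have hTw' : Tw ⊆ Tf := fun v hv => hT₀ (Finset.mem_union_left _ hv)
  have hTρ' : Tρ ⊆ Tf := fun v hv => hT₀ (Finset.mem_union_right _ hv)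
  -- the consumer's named local factors `fl` coincide with the (F3′) ones: the local component of `w` at `v` is `conj χ_{1,v}` (`rfl`)
  obtain ⟨hfl, ⟨B, hB⟩, hsum, hne⟩ := hrows (fun (v : HeightOneSpectrum (𝓞 F)) (g : localPi E c 1 J₁ v) =>
    (((Measure.pi fun _ : Fin n => μ' v) (integralBox F (Fin n) v)).toReal⁻¹ •
      ∫ z, ((𝓢.omegaLoc v (localCenter E c n (Matrix.reindex e e (JV ⊗ₖ J₁)) J₁ hJ₁ v g) (Φ v) :
          ↥(SchwartzBruhat (Fin n → v.adicCompletion F))) : (Fin n → v.adicCompletion F) → ℂ) z *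
        conj (((Φ v : ↥(SchwartzBruhat (Fin n → v.adicCompletion F))) :
          (Fin n → v.adicCompletion F) → ℂ) z) ∂(Measure.pi fun _ : Fin n => μ' v)) *
      w ((finAdelicEquiv F E c 1 J₁).symm (RestrictedProduct.mulSingle (fun v => localInt E c 1 J₁ v) v g))) (by
    funext v g
    rfl)
  refine ⟨Φ, ?_⟩
  haveI : ∀ v : HeightOneSpectrum (𝓞 F), (Measure.pi fun _ : Fin n => μ' v).IsAddHaarMeasure := fun v => by
    haveI : SecondCountableTopology (v.adicCompletion F) := secondCountableTopology_localField _
    infer_instance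
  have hwT : ∀ k ∈ RestrictedProduct.boxSubgroup (fun v => localInt E c 1 J₁ v) Tf, w ((finAdelicEquiv F E c 1 J₁).symm k) = 1 := by
    intro k hk
    have h1 := hTw k (boxSubgroup_antitone (fun v => localInt E c 1 J₁ v) hTw' hk)
    change conj (((ψ ((finAdelicEquiv F E c 1 J₁).symm k) : ℂˣ) : ℂ)) = 1
    rw [h1, Units.val_one, map_one]
  have key := integral_finCoeff_ne_zero_of_localFactors F E c N e JV J₁ hJ₁ hcδ hδ hd Tb hTb hJb 𝓢
    (fun u f => 𝓢.Omega (finPairEmb F E c N 1 e JV J₁ (1, u)) f) (fun _ _ => rfl) w hwc Tf hwT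
    (fun v hv => hTρ v fun h => hv (hTρ' h)) μ (fun v => Measure.pi fun _ : Fin n => μ' v) Φ Φ hΦoff hΦoff μf νW S₀ hi₀ (hS₀ hi₀) hB1
    _ rfl hfl ⟨B, fun S _ _ => hB S⟩ hsum hne
  simpa only [hw_apply] using key

end Family

end Summit.HodgeConjecture.HodgeConjecture.Cruxes.H413.ThetaNonvanishing

end
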